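import Mathlib
import HarnessLib
import Summits.Ventures.LatticeQCDFlow.Exactness.WoodSampler
import Summits.Ventures.LatticeQCDFlow.Exactness.SphereAxisDisintegration
import Summits.Ventures.LatticeQCDFlow.Exactness.GaussianLatitude
import Summits.Ventures.LatticeQCDFlow.Exactness.SU2HeatBathSampler

/-!
# Wood's loop outputs exactly the cosine marginal of the von Mises–Fisher law on the sphere

HONEST FRAMING: exact (Metropolis-corrected) sampling algorithms for lattice gauge theory;
figures of merit are autocorrelation/cost numbers at stated couplings and volumes; no
continuum-physics claim.

Venture `LatticeQCDFlow` (cell pub-lqcd), topic `Exactness`, FANOUT row 9 (eng-latcore, the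
engine `latflow.core`).  NEW WORK of the cell over row 7's `SphereAxisDisintegration.lean`
(`map_angle_polarAxis_toSphere`: under Mathlib's surface measure of `S^{n+1}` the polar angle has
law `|Sⁿ| • sinⁿθ dθ|_{[0,π]}`), row 9's `WoodSampler.lean` (Wood's loop outputs the normalised
`vmfCosLaw κ δ`, density `(1−w²)^{δ/2−1}e^{κw}` on `(−1,1)`), `GaussianLatitude.lean` (the
substitution `c = cos β`) and `SU2HeatBathSampler.lean` (`map_withDensity_comp`).  Nothing is cited
as a fact.  Printed counterparts, NAMED ONLY: Wood 1994; Mardia–Jupp, *Directional Statistics* §9.3.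

The identification named NOT CLAIMED in `WoodSampler.lean`:

* `vmfSphere κ n` — the von Mises–Fisher law on `S^{n+1} ⊂ ℝ^{n+2}` with mean direction `e₀` and
  concentration `κ`, unnormalised: density `e^{κ x₀}` against Mathlib's `volume.toSphere`;
* `cos_angle_polarAxis` (`cos ∠(e₀, x) = x₀` on the sphere); **`lintegral_cos_polarLaw`** — the image
  of `sinⁿθ dθ|_{[0,π]}` under `cos` has density `(1−c²)^{(n−1)/2}` on `(−1,1)` (`n ≥ 1`);
* `cosCoord` (`x ↦ x₀`); **`vmfSphere_map_cosCoord`** — the law of the cosine `x₀` under `vmfSphere κ n` is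
  `|Sⁿ| • vmfCosLaw κ (n+1)`;
* **`loopLaw_woodRound_eq_vmf`** — for `κ ≥ 0`, `n ≥ 1`: Wood's loop with `δ = n + 1 = d − 1`
  outputs EXACTLY the normalised cosine marginal of the vMF law on `S^{d−1}`:
  `loopLaw (woodRound κ (n+1)) = (vmfSphere κ n ℝ)⁻¹ • (vmfSphere κ n).map cosCoord`.

For the engine (`cpn_2d` site heat bath, `d = 2N`, `N ≥ 2`): `n = 2N − 2 ≥ 2`.  NOT CLAIMED: mean
directions other than `e₀` (one rotation away; the engine's `m = F/|F|`), the Beta / Gamma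
generators, the perpendicular component, floating point.
-/

namespace Summit.Ventures.LatticeQCDFlow.Exactness

open MeasureTheory Measure Metric Set Real InnerProductGeometry
open scoped ENNReal RealInnerProductSpace

section VMF

variable (n : ℕ)

/-- On the unit sphere, `cos ∠(e₀, x) = x₀`. -/
theorem cos_angle_polarAxis (x : sphere (0 : EuclideanSpace ℝ (Fin (n + 2))) 1) :
    Real.cos (angle (polarAxis n) (x : EuclideanSpace ℝ (Fin (n + 2)))) =
      (x : EuclideanSpace ℝ (Fin (n + 2))) 0 := by
  rw [InnerProductGeometry.cos_angle, inner_polarAxis, norm_polarAxis, norm_eq_of_mem_sphere x, one_mul, div_one]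

/-- On `(0, π)`: `sinⁿ β = sin β · (1 − cos²β)^{(n−1)/2}` (`n ≥ 1`). -/
theorem sin_pow_eq_sin_mul_rpow {n : ℕ} (hn : 1 ≤ n) {β : ℝ} (hβ : β ∈ Ioo 0 π) :
    Real.sin β ^ n = Real.sin β * (1 - Real.cos β ^ 2) ^ (((n : ℝ) - 1) / 2) := by
  have hs : 0 ≤ Real.sin β := (Real.sin_pos_of_pos_of_lt_pi hβ.1 hβ.2).le
  rw [← Real.sin_sq, ← Real.rpow_natCast (Real.sin β) 2, ← Real.rpow_mul hs,
    show ((2 : ℕ) : ℝ) * (((n : ℝ) - 1) / 2) = ((n - 1 : ℕ) : ℝ) by rw [Nat.cast_sub hn]; push_cast; ring,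
    Real.rpow_natCast, ← pow_succ', Nat.sub_add_cancel hn]

/-- **The image of `sinⁿθ dθ|_{[0,π]}` under `cos`** has density `(1−c²)^{(n−1)/2}` on `(−1,1)`:
for every measurable `h ≥ 0`, `∫ h(cos θ) d(polarLaw n) = ∫_{(−1,1)} (1−c²)^{(n−1)/2} h(c) dc` (`n ≥ 1`). -/
theorem lintegral_cos_polarLaw {n : ℕ} (hn : 1 ≤ n) {h : ℝ → ℝ≥0∞} (hh : Measurable h) :
    ∫⁻ θ, h (Real.cos θ) ∂(polarLaw n) =
      ∫⁻ c in Ioo (-1) 1, ENNReal.ofReal ((1 - c ^ 2) ^ (((n : ℝ) - 1) / 2)) * h c := by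
  have hdens : Measurable fun θ : ℝ => ENNReal.ofReal (Real.sin θ ^ n) := by fun_prop
  rw [polarLaw, lintegral_withDensity_eq_lintegral_mul _ (g := fun θ => h (Real.cos θ)) hdens
    (hh.comp Real.measurable_cos), ← setLIntegral_congr Ioo_ae_eq_Icc]
  have hpt : ∀ β ∈ Ioo (0 : ℝ) π, ((fun θ : ℝ => ENNReal.ofReal (Real.sin θ ^ n)) * fun θ => h (Real.cos θ)) β =
      ENNReal.ofReal (Real.sin β) *
        (ENNReal.ofReal ((1 - Real.cos β ^ 2) ^ (((n : ℝ) - 1) / 2)) * h (Real.cos β)) := by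
    intro β hβ
    rw [Pi.mul_apply, sin_pow_eq_sin_mul_rpow hn hβ, ← mul_assoc,
      ← ENNReal.ofReal_mul (Real.sin_pos_of_pos_of_lt_pi hβ.1 hβ.2).le]
  rw [setLIntegral_congr_fun measurableSet_Ioo hpt,
    lintegral_sin_mul_comp_cos (fun c => ENNReal.ofReal ((1 - c ^ 2) ^ (((n : ℝ) - 1) / 2)) * h c)]

/-- **The von Mises–Fisher law on `S^{n+1}`** with mean direction `e₀` and concentration `κ`
(unnormalised: density `e^{κ x₀}` against Mathlib's surface measure `volume.toSphere`). -/
noncomputable def vmfSphere (κ : ℝ) (n : ℕ) : Measure (sphere (0 : EuclideanSpace ℝ (Fin (n + 2))) 1) :=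
  ((volume : Measure (EuclideanSpace ℝ (Fin (n + 2)))).toSphere).withDensity
    fun x => ENNReal.ofReal (Real.exp (κ * (x : EuclideanSpace ℝ (Fin (n + 2))) 0))

/-- The cosine coordinate `x₀ = m·x` (`m = e₀`) of a point of the sphere. -/
noncomputable def cosCoord (x : sphere (0 : EuclideanSpace ℝ (Fin (n + 2))) 1) : ℝ :=
  (x : EuclideanSpace ℝ (Fin (n + 2))) 0

/-- `cosCoord` is measurable. -/
theorem measurable_cosCoord : Measurable (cosCoord n) :=
  ((measurable_pi_apply 0).comp (WithLp.measurable_ofLp 2 _)).comp measurable_subtype_coe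

/-- `cosCoord = cos ∘ ∠(e₀, ·)`. -/
theorem cosCoord_eq_cos_angle :
    cosCoord n = Real.cos ∘ fun x : sphere (0 : EuclideanSpace ℝ (Fin (n + 2))) 1 =>
      angle (polarAxis n) (x : EuclideanSpace ℝ (Fin (n + 2))) :=
  funext fun x => (cos_angle_polarAxis n x).symm

/-- **The cosine marginal of the vMF law**: the law of `x₀` under `vmfSphere κ n` is
`|Sⁿ| • vmfCosLaw κ (n+1)` — density `∝ (1 − w²)^{(n−1)/2} e^{κw}` on `(−1, 1)` (`n ≥ 1`). -/
theorem vmfSphere_map_cosCoord {n : ℕ} (hn : 1 ≤ n) (κ : ℝ) :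
    (vmfSphere κ n).map (cosCoord n) =
      ((volume : Measure (EuclideanSpace ℝ (Fin (n + 1)))).toSphere univ) • vmfCosLaw κ (n + 1) := by
  have hW : Measurable fun w : ℝ => ENNReal.ofReal (Real.exp (κ * w)) := by fun_prop
  rw [vmfSphere, show (fun x : sphere (0 : EuclideanSpace ℝ (Fin (n + 2))) 1 =>
      ENNReal.ofReal (Real.exp (κ * (x : EuclideanSpace ℝ (Fin (n + 2))) 0))) =
      fun x => (fun w : ℝ => ENNReal.ofReal (Real.exp (κ * w))) (cosCoord n x) from rfl,
    map_withDensity_comp _ (measurable_cosCoord n) hW, cosCoord_eq_cos_angle,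
    ← Measure.map_map Real.measurable_cos (measurable_angle_polarAxis n), map_angle_polarAxis_toSphere n,
    Measure.map_smul, withDensity_smul_measure]
  congr 1
  refine Measure.ext_of_lintegral _ fun h hh => ?_
  rw [lintegral_withDensity_eq_lintegral_mul _ hW hh, lintegral_map (hW.mul hh) Real.measurable_cos,
    lintegral_cos_polarLaw hn (hW.mul hh), vmfCosLaw,
    lintegral_withDensity_eq_lintegral_mul _ (by fun_prop) hh]
  refine setLIntegral_congr_fun measurableSet_Ioo fun c hc => ?_
  rw [Pi.mul_apply, Pi.mul_apply, ← mul_assoc, ← ENNReal.ofReal_mul (Real.rpow_nonneg (by nlinarith [hc.1, hc.2]) _),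
    show ((n : ℝ) + 1) / 2 - 1 = ((n : ℝ) - 1) / 2 by ring]

/-- **Wood's loop outputs EXACTLY the cosine marginal of the von Mises–Fisher law** (`κ ≥ 0`,
`n ≥ 1`, `δ = n + 1 = d − 1`): `loopLaw (woodRound κ (n+1)) = (vmfSphere κ n ℝ)⁻¹ • law of x₀`. -/
theorem loopLaw_woodRound_eq_vmf {κ : ℝ} (hκ : 0 ≤ κ) {n : ℕ} (hn : 1 ≤ n) :
    loopLaw (woodRound κ (n + 1)) = ((vmfSphere κ n) univ)⁻¹ • (vmfSphere κ n).map (cosCoord n) := by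
  have hC0 : ((volume : Measure (EuclideanSpace ℝ (Fin (n + 1)))).toSphere univ) ≠ 0 := toSphere_univ_ne_zero _
  have hCt : ((volume : Measure (EuclideanSpace ℝ (Fin (n + 1)))).toSphere univ) ≠ ∞ := measure_ne_top _ _
  have huniv : (vmfSphere κ n) univ =
      ((volume : Measure (EuclideanSpace ℝ (Fin (n + 1)))).toSphere univ) * vmfCosLaw κ (n + 1) univ := by
    have h := congrArg (fun μ : Measure ℝ => μ univ) (vmfSphere_map_cosCoord hn κ)
    simp only [Measure.map_apply (measurable_cosCoord n) MeasurableSet.univ, preimage_univ, Measure.smul_apply,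
      smul_eq_mul] at h
    exact h
  rw [loopLaw_woodRound hκ (by positivity), vmfSphere_map_cosCoord hn κ, huniv, smul_smul]
  congr 1
  rw [ENNReal.mul_inv (Or.inl hC0) (Or.inl hCt), mul_comm _⁻¹ (vmfCosLaw κ (n + 1) univ)⁻¹, mul_assoc,
    ENNReal.inv_mul_cancel hC0 hCt, mul_one]

end VMF

end Summit.Ventures.LatticeQCDFlow.Exactness
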